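import Literature.IUT.HodgeTheaters.GaloisValDatumOfComplete
import Literature.AnabelianGeometry.AbsoluteAnabelian.MonoAnalyticNonarchAlgorithmModel
import Literature.FieldTheory.Galois.FixingSubgroupAbsoluteGalois
import Literature.AlgebraicGeometry.Frobenioids.PadicOrdIntOfNorm
import Literature.IUT.LogVolume.PadicSubfields
import Mathlib.Analysis.Normed.Unbundled.SpectralNorm
import HarnessLib

/-!
# `ord(𝒪^▷)` of the fixed fields `k̄^U` is an invariant of the topological group `U` ([IUTchI] Ex. 3.3 (iii) (d);
# [AbsAnab] Prop. 1.2.1 (v) "ramification indices are group-theoretic", read on the base `𝓑(K_v)⁰ → D₀`)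

Mochizuki, *Inter-universal Teichmüller theory I*, kurims manuscript (May 2020), Ex. 3.3 (iii) (d) p. 79
[claim: Mochizuki2012, status: disputed] — nothing of the series is asserted; no side is taken on [IUTchIII]
Cor. 3.12.  Mochizuki, *The absolute anabelian geometry of hyperbolic curves* (2004), Prop. 1.2.1 (v) p. 10
[cite: MochizukiAbsAnab2004, Prop 1.2.1 (v) p.10]: an isomorphism of profinite groups `G_{K₁} ≅ G_{K₂}` of absolute
Galois groups of MLF's preserves `[Kᵢ : ℚ_p]` and `[kᵢ : 𝔽_p]`, "in particular, the ramification indices of `K₁`, `K₂`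
over `ℚ_p` coincide" — PROVED in the tree (`galoisMLF_iso_degrees_holds`; invariance of `(p, f, e, m)` for finite
`E ⊆ ℚ̄_p`: `MLFType.ofPadicSubfield_eq_of_galEquiv`).

PROOF-ONLY (abc-iut cell, seat abc-iut-L5-t16 gen 6; row E33iii/d-hram, step 2/3), 0 definitions, no new Prop fact.
For the GENUINE input datum `GaloisValDatum.ofComplete p k` of the field functor `𝓑(K_v)⁰ → D₀` (`k = K_v` complete,
`Ω = k̄` with its spectral norm) and open subgroups `U, U' ⊆ G_v = Gal(k̄/k)` that correspond under a bicontinuous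
automorphism `ψ` of `G_v` (`U' = ψ(U)`), the value monoids of the fixed fields are isomorphic over `ord(p)`:
`ord(𝒪^▷_{k̄^U}) ≅ ord(𝒪^▷_{k̄^{U'}})`, `ord(p) ↦ ord(p)` (`exists_ordInt_mulEquiv_fieldObj_of_map_eq`).  Route:
* `spectralNorm_coe_eq_norm_algHom` — the valuation of `L = k̄^U ⊆ k̄` (restricted spectral norm over `k`) is read
  through ANY `ℚ_p`-embedding `ι : L → ℚ̄_p`: `|x|_{k̄} = ‖ι x‖` (uniqueness of power-multiplicative `ℚ_p`-algebra norms
  on the finite extension `L/ℚ_p`, Mathlib `spectralNorm_unique`);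
* `exists_norm_algHom_eq_rpow`, `exists_ne_zero_norm_algHom_eq_rpow` — hence the value group of `L^×` is
  `p^{(1/e)ℤ}`, `e = e(ι(L)/ℚ_p)` (abc-iut-S1's `exists_norm_eq_rpow`, `exists_norm_eq_rpow_neg` on `ι(L) ⊆ ℚ̄_p`);
* `exists_ordInt_mulEquiv_fieldObj_of_map_eq` — `G_L ≅ Gal(k̄/L) = U ≅ ψ(U) = Gal(k̄/L') ≅ G_{L'}` (the tree's
  `fixingSubgroupEquivAbsoluteGaloisGroup`, infinite Galois theory `fixingSubgroup_fixedField`) transported to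
  `G_{ι(L)} ≅ G_{ι'(L')}` (`PadicAlgCl.galEquivFieldRange`), so `e(ι(L)) = e(ι'(L'))` by [AbsAnab] Prop. 1.2.1 (v)
  (`MLFType.ofPadicSubfield_eq_of_galEquiv`); equal value groups give the isomorphism of `ord(𝒪^▷)` over `ord(p)`
  (`PadicFld.exists_ordInt_mulEquiv_of_normLike`).
Classical (valuation theory + the tree's proof of [AbsAnab] Prop. 1.2.1 (v)); nothing here bears on [IUTchIII] Cor. 3.12.
-/

noncomputable section

namespace Literature.IUT.HodgeTheaters

namespace GaloisValDatum

open Literature.AlgebraicGeometry.Frobenioids Literature.AlgebraicGeometry.Frobenioids.PadicFrd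
open Literature.AnabelianGeometry.SemiGraphs Literature.AnabelianGeometry.AbsoluteAnabelian Field
open Literature.IUT.LogVolume (absRamificationIdx exists_norm_eq_rpow exists_norm_eq_rpow_neg)
open scoped Literature.IUT.LogVolume

section Complete

variable (p : ℕ) [Fact p.Prime] (k : Type) [NontriviallyNormedField k] [CompleteSpace k] [IsUltrametricDist k]
  [NormedAlgebra ℚ_[p] k] [FiniteDimensional ℚ_[p] k]

/-! ### The valuation of a finite `L ⊆ k̄` through a `ℚ_p`-embedding `L → ℚ̄_p` -/

/-- **`|x|_{k̄} = ‖ι x‖_{ℚ̄_p}`** for `x` in a finite subextension `L` of `k̄/k` and any `ℚ_p`-embedding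
`ι : L → ℚ̄_p`: both sides are power-multiplicative `ℚ_p`-algebra norms on the finite extension `L/ℚ_p`, hence equal
to the spectral norm of `L/ℚ_p` (uniqueness of the extension of `|·|_p`; Neukirch, ANT II (4.8)).
[cite: NeukirchANT1999, Ch. II Thm. (4.8)] -/
theorem spectralNorm_coe_eq_norm_algHom (L : IntermediateField k (AlgebraicClosure k)) [FiniteDimensional k L]
    (ι : L →ₐ[ℚ_[p]] PadicAlgCl p) (x : L) :
    spectralNorm k (AlgebraicClosure k) (x : AlgebraicClosure k) = ‖ι x‖ := by
  letI := closureNormedField k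
  haveI : FiniteDimensional ℚ_[p] L := Module.Finite.trans k L
  haveI : Algebra.IsAlgebraic ℚ_[p] L := Algebra.IsAlgebraic.of_finite ℚ_[p] L
  -- the norm of `k̄` restricted to `L`, as a `ℚ_p`-algebra norm
  have hsmul : ∀ (r : ℚ_[p]) (a : L),
      ‖((r • a : L) : AlgebraicClosure k)‖ = ‖r‖ * ‖(a : AlgebraicClosure k)‖ := fun r a => by
    rw [IntermediateField.coe_smul, Algebra.smul_def, norm_mul,
      IsScalarTower.algebraMap_apply ℚ_[p] k (AlgebraicClosure k)]
    congr 1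
    change spectralNorm k (AlgebraicClosure k) _ = _
    rw [spectralNorm_extends, norm_algebraMap']
  let f : AlgebraNorm ℚ_[p] L :=
    { toFun := fun a => ‖(a : AlgebraicClosure k)‖
      map_zero' := by simp only [ZeroMemClass.coe_zero, norm_zero]
      add_le' := fun a b => by simp only [AddMemClass.coe_add]; exact norm_add_le _ _
      neg' := fun a => by simp only [NegMemClass.coe_neg, norm_neg]
      mul_le' := fun a b => by simp only [MulMemClass.coe_mul, norm_mul]; exact le_rfl
      eq_zero_of_map_eq_zero' := fun a ha => by
        have h : (a : AlgebraicClosure k) = 0 := norm_eq_zero.mp ha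
        exact_mod_cast h
      smul' := fun r a => hsmul r a }
  -- the norm of `ℚ̄_p` pulled back along `ι`, as a `ℚ_p`-algebra norm
  let g : AlgebraNorm ℚ_[p] L :=
    { toFun := fun a => ‖ι a‖
      map_zero' := by simp only [map_zero, norm_zero]
      add_le' := fun a b => by simp only [map_add]; exact norm_add_le _ _
      neg' := fun a => by simp only [map_neg, norm_neg]
      mul_le' := fun a b => by simp only [map_mul, norm_mul]; exact le_rfl
      eq_zero_of_map_eq_zero' := fun a ha => by
        have h : ι a = 0 := norm_eq_zero.mp ha
        exact (map_eq_zero_iff ι ι.toRingHom.injective).mp h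
      smul' := fun r a => by simp only [map_smul, norm_smul] }
  have hf : IsPowMul f := fun a n _ => by
    change ‖((a ^ n : L) : AlgebraicClosure k)‖ = ‖(a : AlgebraicClosure k)‖ ^ n
    rw [SubmonoidClass.coe_pow, norm_pow]
  have hg : IsPowMul g := fun a n _ => by
    change ‖ι (a ^ n)‖ = ‖ι a‖ ^ n
    rw [map_pow, norm_pow]
  have h := (spectralNorm_unique hf).trans (spectralNorm_unique hg).symm
  exact congrArg (fun φ : AlgebraNorm ℚ_[p] L => φ x) h

/-- **The value group of `L^×` is `p^{(1/e)ℤ}`**, `e` the absolute ramification index of `ι(L) ⊆ ℚ̄_p`: every nonzero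
`x ∈ L` has `‖ι x‖ = p^{-m/e}` for some `m ∈ ℤ` (abc-iut-S1's `exists_norm_eq_rpow` on the finite `ι(L) ⊆ ℚ̄_p`).
[cite: NeukirchANT1999, Ch. II Thm. (4.8)] -/
theorem exists_norm_algHom_eq_rpow {L : Type*} [Field L] [Algebra ℚ_[p] L] (ι : L →ₐ[ℚ_[p]] PadicAlgCl p)
    [FiniteDimensional ℚ_[p] ι.fieldRange] {x : L} (hx : x ≠ 0) :
    ∃ m : ℤ, ‖ι x‖ = (p : ℝ) ^ (-(m / (absRamificationIdx p ι.fieldRange : ℝ))) := by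
  have hy : (⟨ι x, ι.mem_fieldRange.mpr ⟨x, rfl⟩⟩ : ι.fieldRange) ≠ 0 := fun h =>
    hx ((map_eq_zero_iff ι ι.toRingHom.injective).mp (congrArg Subtype.val h))
  obtain ⟨m, hm⟩ := exists_norm_eq_rpow p ι.fieldRange hy
  exact ⟨m, hm⟩

/-- Conversely every `p^{-m/e}`, `m ∈ ℤ`, is the value `‖ι x‖` of a nonzero `x ∈ L` (a power of a uniformizer of
`ι(L)`; abc-iut-S1's `exists_norm_eq_rpow_neg`). [cite: NeukirchANT1999, Ch. II Thm. (4.8)] -/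
theorem exists_ne_zero_norm_algHom_eq_rpow {L : Type*} [Field L] [Algebra ℚ_[p] L] (ι : L →ₐ[ℚ_[p]] PadicAlgCl p)
    [FiniteDimensional ℚ_[p] ι.fieldRange] (m : ℤ) :
    ∃ x : L, x ≠ 0 ∧ ‖ι x‖ = (p : ℝ) ^ (-(m / (absRamificationIdx p ι.fieldRange : ℝ))) := by
  obtain ⟨g, hg⟩ := exists_norm_eq_rpow_neg p ι.fieldRange m
  obtain ⟨x, hx⟩ := ι.mem_fieldRange.mp (g : ι.fieldRange).2
  refine ⟨x, fun h => g.ne_zero (Subtype.ext ?_), ?_⟩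
  · rw [ZeroMemClass.coe_zero, ← hx, h, map_zero]
  · rw [hx]
    exact hg

/-! ### `ord(𝒪^▷_{k̄^U})` depends only on the topological group `U` -/

/-- **`ord(𝒪^▷_{k̄^U}) ≅ ord(𝒪^▷_{k̄^{ψ(U)}})` over `ord(p)`** for the genuine datum `GaloisValDatum.ofComplete p k`
(`Ω = k̄` with its spectral norm), every bicontinuous automorphism `ψ` of `G_v = Gal(k̄/k)` and open subgroups
`U' = ψ(U)`: with `L = k̄^U`, `L' = k̄^{U'}` (finite over `k`), `G_L ≅ Gal(k̄/L) = U ≅ U' ≅ G_{L'}` as topological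
groups, so by [AbsAnab] Prop. 1.2.1 (v) — PROVED in the tree — the absolute ramification indices of (any
`ℚ_p`-embedded copies in `ℚ̄_p` of) `L`, `L'` coincide; the valuations of `L`, `L'` being read through such embeddings
(`spectralNorm_coe_eq_norm_algHom`), their value groups `p^{(1/e)ℤ}` coincide, whence the isomorphism of value
monoids matching classes of equal absolute value (`PadicFld.exists_ordInt_mulEquiv_of_normLike`).
[cite: MochizukiAbsAnab2004, Prop 1.2.1 (v) p.10] -/
theorem exists_ordInt_mulEquiv_fieldObj_of_map_eq (ψ : (ofComplete p k).Gal ≃ₜ* (ofComplete p k).Gal)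
    (X Y : CosetCat (ofComplete p k).Gal) (hXY : Y.sg.toSubgroup = X.sg.toSubgroup.map ψ.toMulEquiv.toMonoidHom) :
    ∃ ι : OrdInt ((ofComplete p k).fieldObj X).K ≃* OrdInt ((ofComplete p k).fieldObj Y).K,
      ι (Associates.mk ⟨((p : ℕ) : ((ofComplete p k).fieldObj X).K), ((ofComplete p k).fieldObj X).p_mem⟩) =
        Associates.mk ⟨((p : ℕ) : ((ofComplete p k).fieldObj Y).K), ((ofComplete p k).fieldObj Y).p_mem⟩ := by
  haveI := charZero p k
  -- unfolded names: `Ω = k̄`, `G = Gal(k̄/k)`, `L = k̄^U`, `L' = k̄^{U'}`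
  let Ω : Type := AlgebraicClosure k
  let U : OpenSubgroup (Ω ≃ₐ[k] Ω) := X.sg
  let V : OpenSubgroup (Ω ≃ₐ[k] Ω) := Y.sg
  let L : IntermediateField k Ω := IntermediateField.fixedField U.toSubgroup
  let L' : IntermediateField k Ω := IntermediateField.fixedField V.toSubgroup
  haveI : FiniteDimensional k L := (ofComplete p k).finiteDimensional_fixedFld X
  haveI : FiniteDimensional k L' := (ofComplete p k).finiteDimensional_fixedFld Y
  haveI : FiniteDimensional ℚ_[p] L := Module.Finite.trans k L
  haveI : FiniteDimensional ℚ_[p] L' := Module.Finite.trans k L'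
  haveI : Algebra.IsAlgebraic ℚ_[p] L := Algebra.IsAlgebraic.of_finite ℚ_[p] L
  haveI : Algebra.IsAlgebraic ℚ_[p] L' := Algebra.IsAlgebraic.of_finite ℚ_[p] L'
  -- `ℚ_p`-embeddings into `ℚ̄_p` and their images
  let ι : L →ₐ[ℚ_[p]] PadicAlgCl p := IsAlgClosed.lift
  let ι' : L' →ₐ[ℚ_[p]] PadicAlgCl p := IsAlgClosed.lift
  haveI : FiniteDimensional ℚ_[p] ι.fieldRange := LinearEquiv.finiteDimensional ι.equivFieldRange.toLinearEquiv
  haveI : FiniteDimensional ℚ_[p] ι'.fieldRange := LinearEquiv.finiteDimensional ι'.equivFieldRange.toLinearEquiv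
  -- `Gal(k̄/L) = U`, `Gal(k̄/L') = U' = ψ(U)`
  have hL : L.fixingSubgroup = U.toSubgroup := InfiniteGalois.fixingSubgroup_fixedField ⟨U.toSubgroup, U.isClosed⟩
  have hL' : L'.fixingSubgroup = V.toSubgroup := InfiniteGalois.fixingSubgroup_fixedField ⟨V.toSubgroup, V.isClosed⟩
  have hmem : ∀ g : Ω ≃ₐ[k] Ω, g ∈ L.fixingSubgroup → ψ g ∈ L'.fixingSubgroup := fun g hg => by
    rw [hL'] ; rw [hL] at hg
    change ψ g ∈ Y.sg.toSubgroup
    rw [hXY]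
    exact ⟨g, hg, rfl⟩
  have hmem' : ∀ g : Ω ≃ₐ[k] Ω, g ∈ L'.fixingSubgroup → ψ.symm g ∈ L.fixingSubgroup := fun g hg => by
    rw [hL] ; rw [hL'] at hg
    change g ∈ Y.sg.toSubgroup at hg
    rw [hXY] at hg
    obtain ⟨g₀, hg₀, rfl⟩ := hg
    change ψ.symm (ψ g₀) ∈ X.sg.toSubgroup
    rw [ContinuousMulEquiv.symm_apply_apply]
    exact hg₀
  let c : L.fixingSubgroup ≃ₜ* L'.fixingSubgroup :=
    { toFun := fun g => ⟨ψ g.1, hmem g.1 g.2⟩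
      invFun := fun g => ⟨ψ.symm g.1, hmem' g.1 g.2⟩
      left_inv := fun g => Subtype.ext (ContinuousMulEquiv.symm_apply_apply ψ g.1)
      right_inv := fun g => Subtype.ext (ContinuousMulEquiv.apply_symm_apply ψ g.1)
      map_mul' := fun g h => Subtype.ext (map_mul ψ g.1 h.1)
      continuous_toFun := (ψ.continuous.comp continuous_subtype_val).subtype_mk _
      continuous_invFun := (ψ.symm.continuous.comp continuous_subtype_val).subtype_mk _ }
  -- `G_L ≅ G_{L'}`, transported to the copies `ι(L)`, `ι'(L')` in `ℚ̄_p`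
  let α : absoluteGaloisGroup L ≃ₜ* absoluteGaloisGroup L' :=
    ((Literature.FieldTheory.Galois.fixingSubgroupEquivAbsoluteGaloisGroup L).symm.trans c).trans
      (Literature.FieldTheory.Galois.fixingSubgroupEquivAbsoluteGaloisGroup L')
  let β : absoluteGaloisGroup ι.fieldRange ≃ₜ* absoluteGaloisGroup ι'.fieldRange :=
    ((PadicAlgCl.galEquivFieldRange L ι).symm.trans α).trans (PadicAlgCl.galEquivFieldRange L' ι')
  -- [AbsAnab] Prop. 1.2.1 (v): equal absolute ramification indices
  have he : absRamificationIdx p ι.fieldRange = absRamificationIdx p ι'.fieldRange :=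
    congrArg MLFType.e (MLFType.ofPadicSubfield_eq_of_galEquiv ι.fieldRange ι'.fieldRange β)
  -- the valuations of `L`, `L'` read through `ι`, `ι'`
  have hX : ∀ a b : ((ofComplete p k).fieldObj X).K, a ≤ᵥ b ↔ ‖ι a‖ ≤ ‖ι b‖ := fun a b => by
    refine ((ofComplete p k).valOn_iff _ a b).trans ?_
    refine (closureVal_iff k _ _).trans ?_
    rw [spectralNorm_coe_eq_norm_algHom p k L ι a, spectralNorm_coe_eq_norm_algHom p k L ι b]
  have hY : ∀ a b : ((ofComplete p k).fieldObj Y).K, a ≤ᵥ b ↔ ‖ι' a‖ ≤ ‖ι' b‖ := fun a b => by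
    refine ((ofComplete p k).valOn_iff _ a b).trans ?_
    refine (closureVal_iff k _ _).trans ?_
    rw [spectralNorm_coe_eq_norm_algHom p k L' ι' a, spectralNorm_coe_eq_norm_algHom p k L' ι' b]
  -- (the ring structure of `(fieldObj X).K` is that of `L` — restate the algebraic identities over `L`, `L'`)
  refine PadicFld.exists_ordInt_mulEquiv_of_normLike _ _ (fun a => ‖ι a‖) (fun b => ‖ι' b‖) hX hY
    (fun a b => by exact (congrArg (‖·‖) (map_mul ι a b)).trans (norm_mul _ _))
    (fun a b => by exact (congrArg (‖·‖) (map_mul ι' a b)).trans (norm_mul _ _))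
    (by change ‖ι (1 : L)‖ = 1; rw [map_one, norm_one]) (by change ‖ι' (1 : L')‖ = 1; rw [map_one, norm_one])
    (by change ‖ι ((p : ℕ) : L)‖ = ‖ι' ((p : ℕ) : L')‖; rw [map_natCast, map_natCast])
    (fun a ha => ?_) (fun b hb => ?_)
  · obtain ⟨m, hm⟩ := exists_norm_algHom_eq_rpow p ι ha
    obtain ⟨b, hb0, hb⟩ := exists_ne_zero_norm_algHom_eq_rpow p ι' m
    exact ⟨b, hb0, by rw [hb, hm, he]⟩
  · obtain ⟨m, hm⟩ := exists_norm_algHom_eq_rpow p ι' hb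
    obtain ⟨a, ha0, ha⟩ := exists_ne_zero_norm_algHom_eq_rpow p ι m
    exact ⟨a, ha0, by rw [ha, hm, he]⟩

end Complete

end GaloisValDatum

end Literature.IUT.HodgeTheaters

end
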